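import Summits.Ventures.WeilGRH.UniformConductorFloorCoprimeData57
import Summits.Ventures.WeilGRH.UniformConductorFloorCellsOne
import Summits.Ventures.WeilGRH.UniformConductorFloorRungs
import HarnessLib

/-!
# GRH arm (rh-explicit, venture WeilGRH): divisibility floors II — the transcendental inputs of the level-`5, 7, 10, 15` certificates

Cell `rh-explicit`, WEIL TRACK — GRH ARM (weil-grh-1, gen8).  For the five joint cell certificates `certEvenDvd7`, `certEvenDvd5`,
`certOddDvd5`, `certOddDvd15`, `certOddDvd10` of `UniformConductorFloorCoprimeData57.lean` (window `t = 320 log(320/319) ≥ 1`): the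
weight bounds `Λ(n)/√n ≤ W_n/2^20` on the prime powers `n ≤ 7` PRIME TO `m` (`UniformFloor.wbar7_ge`; the other weights are `0`),
the elementary logarithm bounds `log 77 ≥ 4 log 3 − 4/77`, `log 60 ≥ 6 log 2 − 1/15`, `log 25 ≥ 3 log 3 − 2/25`,
`log 15 ≥ 4 log 2 − 1/15`, `log 10 ≥ 2 log 3 + 1/10` (`log x ≤ x − 1`, `1 − 1/x ≤ log x`), and the five budget inequalities
`log π − ψ₀ − Clow/D + RHO/D ≤ log Q₀` with `Q₀ = 77` (`m = 7`, even), `60 / 25` (`m = 5`), `15` (`m = 15`, odd), `10`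
(`m = 10`, odd) (`ψ₀` = the tree's `psi_even_ge` / `psi_odd_ge` constants, `log π ≤ 1.1447299`).  Consumed by
`UniformConductorFloorCoprimeFloors57.lean`.  No definitions; no named facts; standard axioms. [folklore]
-/

noncomputable section

open Real Set
open scoped ArithmeticFunction.vonMangoldt

namespace Summit.Ventures.WeilGRH

open Literature.NumberTheory.LFunctions

namespace UniformFloor

/-! ## The weights -/

/-- The weights of `certEvenDvd7` dominate `Λ(n)/√n` on the `n ≤ 7` prime to `7` (`W_n = ⌈2^20 w̄_n⌉`, `UniformFloor.wbar7_ge`);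
the other weights are `0`. [folklore] -/
theorem certEvenDvd7_hw : ∀ n ∈ Finset.range (certEvenDvd7.N + 1),
    (if n.Coprime 7 then (Λ n : ℝ) / Real.sqrt n else 0) ≤ certEvenDvd7.wbar n := by
  intro n hn
  have hn8 : n < 8 := by simpa [show certEvenDvd7.N = 7 from rfl] using Finset.mem_range.1 hn
  have hw := wbar7_ge 7 le_rfl n (Finset.mem_range.2 hn8)
  unfold JointCert.wbar
  rw [show certEvenDvd7.D = 1048576 from rfl]
  interval_cases n
  · rw [if_neg (by decide), show certEvenDvd7.weights.getD 0 0 = 0 from rfl]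
    norm_num
  · rw [if_pos (by decide), show certEvenDvd7.weights.getD 1 0 = 0 from rfl]
    exact hw.trans (by norm_num [wbar7])
  · rw [if_pos (by decide), show certEvenDvd7.weights.getD 2 0 = 513950 from rfl]
    exact hw.trans (by norm_num [wbar7])
  · rw [if_pos (by decide), show certEvenDvd7.weights.getD 3 0 = 665112 from rfl]
    exact hw.trans (by norm_num [wbar7])
  · rw [if_pos (by decide), show certEvenDvd7.weights.getD 4 0 = 363409 from rfl]
    exact hw.trans (by norm_num [wbar7])
  · rw [if_pos (by decide), show certEvenDvd7.weights.getD 5 0 = 754726 from rfl]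
    exact hw.trans (by norm_num [wbar7])
  · rw [if_pos (by decide), show certEvenDvd7.weights.getD 6 0 = 0 from rfl]
    exact hw.trans (by norm_num [wbar7])
  · rw [if_neg (by decide), show certEvenDvd7.weights.getD 7 0 = 0 from rfl]
    norm_num

/-- The weights of `certEvenDvd5` dominate `Λ(n)/√n` on the `n ≤ 7` prime to `5` (`W_n = ⌈2^20 w̄_n⌉`, `UniformFloor.wbar7_ge`);
the other weights are `0`. [folklore] -/
theorem certEvenDvd5_hw : ∀ n ∈ Finset.range (certEvenDvd5.N + 1),
    (if n.Coprime 5 then (Λ n : ℝ) / Real.sqrt n else 0) ≤ certEvenDvd5.wbar n := by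
  intro n hn
  have hn8 : n < 8 := by simpa [show certEvenDvd5.N = 7 from rfl] using Finset.mem_range.1 hn
  have hw := wbar7_ge 7 le_rfl n (Finset.mem_range.2 hn8)
  unfold JointCert.wbar
  rw [show certEvenDvd5.D = 1048576 from rfl]
  interval_cases n
  · rw [if_neg (by decide), show certEvenDvd5.weights.getD 0 0 = 0 from rfl]
    norm_num
  · rw [if_pos (by decide), show certEvenDvd5.weights.getD 1 0 = 0 from rfl]
    exact hw.trans (by norm_num [wbar7])
  · rw [if_pos (by decide), show certEvenDvd5.weights.getD 2 0 = 513950 from rfl]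
    exact hw.trans (by norm_num [wbar7])
  · rw [if_pos (by decide), show certEvenDvd5.weights.getD 3 0 = 665112 from rfl]
    exact hw.trans (by norm_num [wbar7])
  · rw [if_pos (by decide), show certEvenDvd5.weights.getD 4 0 = 363409 from rfl]
    exact hw.trans (by norm_num [wbar7])
  · rw [if_neg (by decide), show certEvenDvd5.weights.getD 5 0 = 0 from rfl]
    norm_num
  · rw [if_pos (by decide), show certEvenDvd5.weights.getD 6 0 = 0 from rfl]
    exact hw.trans (by norm_num [wbar7])
  · rw [if_pos (by decide), show certEvenDvd5.weights.getD 7 0 = 771213 from rfl]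
    exact hw.trans (by norm_num [wbar7])

/-- The weights of `certOddDvd5` dominate `Λ(n)/√n` on the `n ≤ 7` prime to `5` (`W_n = ⌈2^20 w̄_n⌉`, `UniformFloor.wbar7_ge`);
the other weights are `0`. [folklore] -/
theorem certOddDvd5_hw : ∀ n ∈ Finset.range (certOddDvd5.N + 1),
    (if n.Coprime 5 then (Λ n : ℝ) / Real.sqrt n else 0) ≤ certOddDvd5.wbar n := by
  intro n hn
  have hn8 : n < 8 := by simpa [show certOddDvd5.N = 7 from rfl] using Finset.mem_range.1 hn
  have hw := wbar7_ge 7 le_rfl n (Finset.mem_range.2 hn8)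
  unfold JointCert.wbar
  rw [show certOddDvd5.D = 1048576 from rfl]
  interval_cases n
  · rw [if_neg (by decide), show certOddDvd5.weights.getD 0 0 = 0 from rfl]
    norm_num
  · rw [if_pos (by decide), show certOddDvd5.weights.getD 1 0 = 0 from rfl]
    exact hw.trans (by norm_num [wbar7])
  · rw [if_pos (by decide), show certOddDvd5.weights.getD 2 0 = 513950 from rfl]
    exact hw.trans (by norm_num [wbar7])
  · rw [if_pos (by decide), show certOddDvd5.weights.getD 3 0 = 665112 from rfl]
    exact hw.trans (by norm_num [wbar7])
  · rw [if_pos (by decide), show certOddDvd5.weights.getD 4 0 = 363409 from rfl]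
    exact hw.trans (by norm_num [wbar7])
  · rw [if_neg (by decide), show certOddDvd5.weights.getD 5 0 = 0 from rfl]
    norm_num
  · rw [if_pos (by decide), show certOddDvd5.weights.getD 6 0 = 0 from rfl]
    exact hw.trans (by norm_num [wbar7])
  · rw [if_pos (by decide), show certOddDvd5.weights.getD 7 0 = 771213 from rfl]
    exact hw.trans (by norm_num [wbar7])

/-- The weights of `certOddDvd15` dominate `Λ(n)/√n` on the `n ≤ 7` prime to `15` (`W_n = ⌈2^20 w̄_n⌉`, `UniformFloor.wbar7_ge`);
the other weights are `0`. [folklore] -/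
theorem certOddDvd15_hw : ∀ n ∈ Finset.range (certOddDvd15.N + 1),
    (if n.Coprime 15 then (Λ n : ℝ) / Real.sqrt n else 0) ≤ certOddDvd15.wbar n := by
  intro n hn
  have hn8 : n < 8 := by simpa [show certOddDvd15.N = 7 from rfl] using Finset.mem_range.1 hn
  have hw := wbar7_ge 7 le_rfl n (Finset.mem_range.2 hn8)
  unfold JointCert.wbar
  rw [show certOddDvd15.D = 1048576 from rfl]
  interval_cases n
  · rw [if_neg (by decide), show certOddDvd15.weights.getD 0 0 = 0 from rfl]
    norm_num
  · rw [if_pos (by decide), show certOddDvd15.weights.getD 1 0 = 0 from rfl]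
    exact hw.trans (by norm_num [wbar7])
  · rw [if_pos (by decide), show certOddDvd15.weights.getD 2 0 = 513950 from rfl]
    exact hw.trans (by norm_num [wbar7])
  · rw [if_neg (by decide), show certOddDvd15.weights.getD 3 0 = 0 from rfl]
    norm_num
  · rw [if_pos (by decide), show certOddDvd15.weights.getD 4 0 = 363409 from rfl]
    exact hw.trans (by norm_num [wbar7])
  · rw [if_neg (by decide), show certOddDvd15.weights.getD 5 0 = 0 from rfl]
    norm_num
  · rw [if_neg (by decide), show certOddDvd15.weights.getD 6 0 = 0 from rfl]
    norm_num
  · rw [if_pos (by decide), show certOddDvd15.weights.getD 7 0 = 771213 from rfl]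
    exact hw.trans (by norm_num [wbar7])

/-- The weights of `certOddDvd10` dominate `Λ(n)/√n` on the `n ≤ 7` prime to `10` (`W_n = ⌈2^20 w̄_n⌉`, `UniformFloor.wbar7_ge`);
the other weights are `0`. [folklore] -/
theorem certOddDvd10_hw : ∀ n ∈ Finset.range (certOddDvd10.N + 1),
    (if n.Coprime 10 then (Λ n : ℝ) / Real.sqrt n else 0) ≤ certOddDvd10.wbar n := by
  intro n hn
  have hn8 : n < 8 := by simpa [show certOddDvd10.N = 7 from rfl] using Finset.mem_range.1 hn
  have hw := wbar7_ge 7 le_rfl n (Finset.mem_range.2 hn8)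
  unfold JointCert.wbar
  rw [show certOddDvd10.D = 1048576 from rfl]
  interval_cases n
  · rw [if_neg (by decide), show certOddDvd10.weights.getD 0 0 = 0 from rfl]
    norm_num
  · rw [if_pos (by decide), show certOddDvd10.weights.getD 1 0 = 0 from rfl]
    exact hw.trans (by norm_num [wbar7])
  · rw [if_neg (by decide), show certOddDvd10.weights.getD 2 0 = 0 from rfl]
    norm_num
  · rw [if_pos (by decide), show certOddDvd10.weights.getD 3 0 = 665112 from rfl]
    exact hw.trans (by norm_num [wbar7])
  · rw [if_neg (by decide), show certOddDvd10.weights.getD 4 0 = 0 from rfl]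
    norm_num
  · rw [if_neg (by decide), show certOddDvd10.weights.getD 5 0 = 0 from rfl]
    norm_num
  · rw [if_neg (by decide), show certOddDvd10.weights.getD 6 0 = 0 from rfl]
    norm_num
  · rw [if_pos (by decide), show certOddDvd10.weights.getD 7 0 = 771213 from rfl]
    exact hw.trans (by norm_num [wbar7])

/-! ## Logarithms of the floors -/

/-- `log 77 ≥ 4 log 3 − 4/77` (`77 = 81·(77/81)`, `log x ≤ x − 1`). [folklore] -/
theorem log_77_ge : 4 * Real.log 3 - 4 / 77 ≤ Real.log 77 := by
  have hl : Real.log ((81 : ℝ) / 77) ≤ 81 / 77 - 1 := Real.log_le_sub_one_of_pos (by norm_num)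
  rw [Real.log_div (by norm_num) (by norm_num), show (81 : ℝ) = 3 ^ 4 by norm_num, Real.log_pow] at hl
  push_cast at hl
  linarith

/-- `log 60 ≥ 6 log 2 − 1/15` (`60 = 64·(60/64)`). [folklore] -/
theorem log_60_ge : 6 * Real.log 2 - 1 / 15 ≤ Real.log 60 := by
  have hl : Real.log ((64 : ℝ) / 60) ≤ 64 / 60 - 1 := Real.log_le_sub_one_of_pos (by norm_num)
  rw [Real.log_div (by norm_num) (by norm_num), show (64 : ℝ) = 2 ^ 6 by norm_num, Real.log_pow] at hl
  push_cast at hl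
  linarith

/-- `log 25 ≥ 3 log 3 − 2/25` (`25 = 27·(25/27)`). [folklore] -/
theorem log_25_ge : 3 * Real.log 3 - 2 / 25 ≤ Real.log 25 := by
  have hl : Real.log ((27 : ℝ) / 25) ≤ 27 / 25 - 1 := Real.log_le_sub_one_of_pos (by norm_num)
  rw [Real.log_div (by norm_num) (by norm_num), show (27 : ℝ) = 3 ^ 3 by norm_num, Real.log_pow] at hl
  push_cast at hl
  linarith

/-- `log 15 ≥ 4 log 2 − 1/15` (`15 = 16·(15/16)`). [folklore] -/
theorem log_15_ge : 4 * Real.log 2 - 1 / 15 ≤ Real.log 15 := by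
  have hl : Real.log ((16 : ℝ) / 15) ≤ 16 / 15 - 1 := Real.log_le_sub_one_of_pos (by norm_num)
  rw [Real.log_div (by norm_num) (by norm_num), show (16 : ℝ) = 2 ^ 4 by norm_num, Real.log_pow] at hl
  push_cast at hl
  linarith

/-- `log 10 ≥ 2 log 3 + 1/10` (`10 = 9·(10/9)`, `1 − 1/x ≤ log x`). [folklore] -/
theorem log_10_ge : 2 * Real.log 3 + 1 / 10 ≤ Real.log 10 := by
  have hl : 1 - ((10 : ℝ) / 9)⁻¹ ≤ Real.log ((10 : ℝ) / 9) := Real.one_sub_inv_le_log_of_pos (by norm_num)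
  rw [Real.log_div (by norm_num) (by norm_num), show (9 : ℝ) = 3 ^ 2 by norm_num, Real.log_pow] at hl
  push_cast at hl
  norm_num at hl
  linarith

/-! ## The budgets -/

/-- The budget of `certEvenDvd7`: `log π − (-4.22745354) − Clow/D + RHO/D ≤ log 77` (`= 4.309160 ≤ 4.343805`). [folklore] -/
theorem certEvenDvd7_budget :
    Real.log Real.pi - (-4.22745354) - (certEvenDvd7.Clow : ℝ) / certEvenDvd7.D + (certEvenDvd7.RHO : ℝ) / certEvenDvd7.D ≤
      Real.log (77 : ℕ) := by
  have hπ := Literature.Analysis.SpecialFunctions.Real.log_pi_le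
  have h2 := Real.log_two_gt_d9
  have h3 := Real.log_three_gt_d9
  have hQ := log_77_ge
  rw [show certEvenDvd7.Clow = 7676640 from rfl, show certEvenDvd7.D = 1048576 from rfl,
    show certEvenDvd7.RHO = 6561979 from rfl]
  push_cast
  linarith

/-- The budget of `certEvenDvd5`: `log π − (-4.22745354) − Clow/D + RHO/D ≤ log 60` (`= 4.073849 ≤ 4.094345`). [folklore] -/
theorem certEvenDvd5_budget :
    Real.log Real.pi - (-4.22745354) - (certEvenDvd5.Clow : ℝ) / certEvenDvd5.D + (certEvenDvd5.RHO : ℝ) / certEvenDvd5.D ≤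
      Real.log (60 : ℕ) := by
  have hπ := Literature.Analysis.SpecialFunctions.Real.log_pi_le
  have h2 := Real.log_two_gt_d9
  have hQ := log_60_ge
  rw [show certEvenDvd5.Clow = 7676640 from rfl, show certEvenDvd5.D = 1048576 from rfl,
    show certEvenDvd5.RHO = 6315238 from rfl]
  push_cast
  linarith

/-- The budget of `certOddDvd5`: `log π − (-1.08586154) − Clow/D + RHO/D ≤ log 25` (`= 3.142970 ≤ 3.218876`). [folklore] -/
theorem certOddDvd5_budget :
    Real.log Real.pi - (-1.08586154) - (certOddDvd5.Clow : ℝ) / certOddDvd5.D + (certOddDvd5.RHO : ℝ) / certOddDvd5.D ≤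
      Real.log (25 : ℕ) := by
  have hπ := Literature.Analysis.SpecialFunctions.Real.log_pi_le
  have h3 := Real.log_three_gt_d9
  have hQ := log_25_ge
  rw [show certOddDvd5.Clow = 4399980 from rfl, show certOddDvd5.D = 1048576 from rfl,
    show certOddDvd5.RHO = 5356678 from rfl]
  push_cast
  linarith

/-- The budget of `certOddDvd15`: `log π − (-1.08586154) − Clow/D + RHO/D ≤ log 15` (`= 2.579101 ≤ 2.708050`). [folklore] -/
theorem certOddDvd15_budget :
    Real.log Real.pi - (-1.08586154) - (certOddDvd15.Clow : ℝ) / certOddDvd15.D + (certOddDvd15.RHO : ℝ) / certOddDvd15.D ≤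
      Real.log (15 : ℕ) := by
  have hπ := Literature.Analysis.SpecialFunctions.Real.log_pi_le
  have h2 := Real.log_two_gt_d9
  have hQ := log_15_ge
  rw [show certOddDvd15.Clow = 4399980 from rfl, show certOddDvd15.D = 1048576 from rfl,
    show certOddDvd15.RHO = 4765419 from rfl]
  push_cast
  linarith

/-- The budget of `certOddDvd10`: `log π − (-1.08586154) − Clow/D + RHO/D ≤ log 10` (`= 2.288394 ≤ 2.302585`). [folklore] -/
theorem certOddDvd10_budget :
    Real.log Real.pi - (-1.08586154) - (certOddDvd10.Clow : ℝ) / certOddDvd10.D + (certOddDvd10.RHO : ℝ) / certOddDvd10.D ≤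
      Real.log (10 : ℕ) := by
  have hπ := Literature.Analysis.SpecialFunctions.Real.log_pi_le
  have h3 := Real.log_three_gt_d9
  have hQ := log_10_ge
  rw [show certOddDvd10.Clow = 4399980 from rfl, show certOddDvd10.D = 1048576 from rfl,
    show certOddDvd10.RHO = 4460590 from rfl]
  push_cast
  linarith

end UniformFloor

end Summit.Ventures.WeilGRH

end
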